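import Summits.Ventures.YMGap.RobustBall.StateDerivativeStar
import Summits.Ventures.YMGap.RobustBall.SecondSusceptibilityStar
import Literature.Probability.LatticeModels.RescaledUrsellUniformOnCompact
import HarnessLib

/-!
# Venture YMGap, track ROBUST-BALL (Y2) — THROUGH THE STAR DOOR: THE SUSCEPTIBILITY SERIES IS DIFFERENTIABLE ALONG EVERY LINE OF THE
# GAUGE-INVARIANT BALL, WITH DERIVATIVE THE ABSOLUTELY CONVERGENT DOUBLE SERIES OF THIRD CUMULANTS (the star twin of `StateSecondDerivativeS`)

HONEST FRAMING. WHAT THIS IS: a venture file (cell `pub-ymgap`, track Y2 ROBUST-BALL, seat rb-p1, theorems only).  Setting of `StateDerivativeStar`: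
`(W, supp) ∈ MemBallZdG ε₀ ε₁ R`, line direction `(V, suppV) ∈ MemBallZdG ε₀V ε₁V R_V` with oscillation witnesses of window load `≤ B_V` and
Frobenius-Lipschitz witnesses of total load `≤ L` and SIZE-WEIGHTED load `≤ L₂` through every link; a UNIFORM star window bound (radius
`D ≥ max R R_V + 2`, received sum `0 ≤ ρ < 1`) for `W + s·𝟙_T V`, every set of terms `T`, every `|s| ≤ s₀`; `ν(s)` the DLR states of `W + sV` on `|s| ≤ s₀`;
observable direction `V'` (continuous own-link terms, Lipschitz witnesses of loads `≤ L'`, `≤ L₂'`); `F` bounded measurable local Frobenius-Lipschitz.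
* `hasDerivAt_cov_of_mem_perturbedGibbsMeasures_add_smul` — TIER-1 FEYNMAN–HELLMANN FOR COVARIANCES along a local line;
* ★★★ `hasDerivAt_tsum_cov_direction_star` — at every `|s| < s₀`: `HasDerivAt (s ↦ Σ'_X cov_{ν(s)}(F, V'_X)) (−Σ'_{(X,Y)} u₃^{ν(s)}(F; V'_X; V_Y)) s`, and
  the double cumulant series is CONTINUOUS on `|s| ≤ s₀` — the second Gateaux differential of the state through the star door (bilinear in the pair
  of directions).  Mechanism: Feynman–Hellmann for covariances along the truncated lines, the summable star majorant of the third cumulants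
  (`SecondSusceptibilityStar`), uniform convergence of third cumulants along truncations (`TruncationConvergenceStar` + products of uniformly
  convergent bounded families), the truncated-series lemmas of `TruncatedSeriesDerivative` on PAIRS of link sets.
The `C²` statement (`ContDiffOn ℝ 2`), the `SU(2)` cell for every `0 ≤ β_W ≤ 1/3` and the coupling direction are in `SecondDerivativeStarCells`.
WHAT THIS IS NOT: `C³` or analyticity; one-sided comparison constants; lattice strong coupling only; nothing continuum / Clay-sense mass gap.
-/

noncomputable section

open MeasureTheory ProbabilityTheory Function Finset Real Filter Topology
open scoped NNReal
open Literature.Probability.LatticeModels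
open Literature.Probability.LatticeModels.DobrushinMetric
open Literature.MathematicalPhysics.QuantumLattice
open Literature.MathematicalPhysics.QuantumFieldTheory hiding ZdEdge
open Summit.Ventures.YMGap.DSWindowZd

namespace Summit.Ventures.YMGap.RobustBall

variable {d N : ℕ}

/-! ### Feynman–Hellmann for covariances along a local line (tier 1) -/

section FH

variable {G : Type*} [Group G] [TopologicalSpace G] [IsTopologicalGroup G] [CompactSpace G] [MeasurableSpace G] [BorelSpace G]
  [SecondCountableTopology G] [T2Space G] (ρ : G →* Matrix (Fin N) (Fin N) ℂ)

/-- **Feynman–Hellmann for covariances along a local line (tier 1).**  `(W, supp)` adapted bounded supported (unique DLR state `μ`), `(V, suppV)`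
adapted bounded with `suppV ⊆ T` (finitely many terms), `ν(s) ∈ 𝒢(W + sV)`; `F`, `G` bounded measurable.  Then at every `b`:
`d/ds cov_{ν(s)}(F, G) = −Σ_{A∈T} (cov(FG, V_A) − ⟨F⟩cov(G, V_A) − ⟨G⟩cov(F, V_A))` (all moments at `ν(b)`). -/
theorem hasDerivAt_cov_of_mem_perturbedGibbsMeasures_add_smul (hρ : Continuous ρ) (β : ℝ)
    {W : Potential (ZdEdge d) G} (hW : W.IsAdapted) (hWb : ∀ X, ∃ C, ∀ U, |W X U| ≤ C)
    {supp : Finset (ZdEdge d) → Finset (Finset (ZdEdge d))} (hsupp : W.IsSupportedBy supp)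
    {V : Potential (ZdEdge d) G} (hV : V.IsAdapted) (hVb : ∀ X, ∃ C, ∀ U, |V X U| ≤ C)
    {suppV : Finset (ZdEdge d) → Finset (Finset (ZdEdge d))} (hsuppV : V.IsSupportedBy suppV)
    {T : Finset (Finset (ZdEdge d))} (hT : ∀ Λ, suppV Λ ⊆ T)
    (huniq : (perturbedGibbsMeasures ρ β W supp).Subsingleton)
    {μ : Measure (LGConfig d G)} (hμ : μ ∈ perturbedGibbsMeasures ρ β W supp)
    {ν : ℝ → Measure (LGConfig d G)} (hν : ∀ s, ν s ∈ perturbedGibbsMeasures ρ β (W + s • V) (fun Λ => supp Λ ∪ suppV Λ))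
    {F : LGConfig d G → ℝ} (hFm : Measurable F) {CF : ℝ} (hFb : ∀ U, |F U| ≤ CF)
    {G' : LGConfig d G → ℝ} (hGm : Measurable G') {CG : ℝ} (hGb : ∀ U, |G' U| ≤ CG) (b : ℝ) :
    HasDerivAt (fun s => cov[F, G'; ν s])
      (-(∑ A ∈ T, (cov[fun U => F U * G' U, V A; ν b] - (∫ U, F U ∂(ν b)) * cov[G', V A; ν b] -
        (∫ U, G' U ∂(ν b)) * cov[F, V A; ν b]))) b := by
  have hprob : ∀ s, IsProbabilityMeasure (ν s) := fun s => (show IsGibbsMeasure _ _ from hν s).isProbabilityMeasure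
  have hCF0 : 0 ≤ CF := (abs_nonneg _).trans (hFb 1)
  have hFG : ∀ U, |F U * G' U| ≤ CF * CG := fun U => by rw [abs_mul]; exact mul_le_mul (hFb U) (hGb U) (abs_nonneg _) hCF0
  have hFGm : Measurable (fun U => F U * G' U) := hFm.mul hGm
  have h1 := hasDerivAt_integral_of_mem_perturbedGibbsMeasures_add_smul ρ hρ β hW hWb hsupp hV hVb hsuppV hT huniq hμ hν hFGm hFG b
  have h2 := hasDerivAt_integral_of_mem_perturbedGibbsMeasures_add_smul ρ hρ β hW hWb hsupp hV hVb hsuppV hT huniq hμ hν hFm hFb b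
  have h3 := hasDerivAt_integral_of_mem_perturbedGibbsMeasures_add_smul ρ hρ β hW hWb hsupp hV hVb hsuppV hT huniq hμ hν hGm hGb b
  have hcov : (fun s => cov[F, G'; ν s]) = fun s => (∫ U, F U * G' U ∂(ν s)) - (∫ U, F U ∂(ν s)) * ∫ U, G' U ∂(ν s) := by
    funext s
    haveI := hprob s
    have hF2 : MemLp F 2 (ν s) := MemLp.of_bound hFm.aestronglyMeasurable CF (Eventually.of_forall fun U => by rw [Real.norm_eq_abs]; exact hFb U)
    have hG2 : MemLp G' 2 (ν s) := MemLp.of_bound hGm.aestronglyMeasurable CG (Eventually.of_forall fun U => by rw [Real.norm_eq_abs]; exact hGb U)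
    rw [covariance_eq_sub hF2 hG2]; rfl
  rw [hcov]
  refine (h1.sub (h2.mul h3)).congr_deriv ?_
  haveI := hprob b
  choose CV hCV using hVb
  have hV2 : ∀ A ∈ T, MemLp (fun U => V A U) 2 (ν b) := fun A _ =>
    MemLp.of_bound (hV A).2.aestronglyMeasurable (CV A) (Eventually.of_forall fun U => by rw [Real.norm_eq_abs]; exact hCV A U)
  have hF2 : MemLp F 2 (ν b) := MemLp.of_bound hFm.aestronglyMeasurable CF (Eventually.of_forall fun U => by rw [Real.norm_eq_abs]; exact hFb U)
  have hG2 : MemLp G' 2 (ν b) := MemLp.of_bound hGm.aestronglyMeasurable CG (Eventually.of_forall fun U => by rw [Real.norm_eq_abs]; exact hGb U)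
  have hFG2 : MemLp (fun U => F U * G' U) 2 (ν b) :=
    MemLp.of_bound hFGm.aestronglyMeasurable (CF * CG) (Eventually.of_forall fun U => by rw [Real.norm_eq_abs]; exact hFG U)
  rw [covariance_fun_sum_right' hV2 hFG2, covariance_fun_sum_right' hV2 hF2, covariance_fun_sum_right' hV2 hG2]
  simp only [Finset.sum_sub_distrib, ← Finset.mul_sum]
  ring

end FH

/-! ### The second derivative along a direction through the star door -/

section Main

variable {W V V' : Potential (ZdEdge d) (SUN N)} {supp suppV : Finset (ZdEdge d) → Finset (Finset (ZdEdge d))}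

/-- ★★★ **THROUGH THE STAR DOOR, THE SUSCEPTIBILITY SERIES OF ONE DIRECTION IS DIFFERENTIABLE ALONG ANOTHER; ITS DERIVATIVE IS THE DOUBLE CUMULANT
SERIES.**  `(W, supp) ∈ MemBallZdG ε₀ ε₁ R`, line direction `(V, suppV) ∈ MemBallZdG ε₀V ε₁V R_V` (oscillation witnesses of window load `≤ B_V`, Lipschitz
witnesses of total load `≤ L` and size-weighted load `≤ L₂`); uniform star window bound (radius `D ≥ max R R_V + 2`, received sum `0 ≤ ρ < 1`) for
`W + s·𝟙_T V`, every `T`, `|s| ≤ s₀`; `ν(s) ∈ 𝒢(W + sV)` on `|s| ≤ s₀`; observable direction `V'` (continuous own-link terms, Lipschitz witnesses of loads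
`≤ L'`, `≤ L₂'`); `F` bounded measurable local Frobenius-Lipschitz.  Then (i) at every `|s| < s₀`:
`HasDerivAt (s ↦ Σ'_X cov_{ν(s)}(F, V'_X)) (−Σ'_{(X,Y)} u₃^{ν(s)}(F; V'_X; V_Y)) s`; (ii) the double cumulant series is continuous on `|s| ≤ s₀`. -/
theorem hasDerivAt_tsum_cov_direction_star (hd : 1 ≤ d) {β ε₀ ε₁ ε₀V ε₁V s₀ ρ BV L L₂ L' L₂' : ℝ} {R RV D : ℕ}
    (hW : MemBallZdG ε₀ ε₁ R W supp) (hV : MemBallZdG ε₀V ε₁V RV V suppV) (h₀V : 0 ≤ ε₀V) (h₁V : 0 ≤ ε₁V)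
    {oscV : Finset (ZdEdge d) → ZdEdge d → ℝ} (hoscV : ∀ X, Dobrushin.IsOscBound (V X) (oscV X))
    (hBV : ∀ c : ZdEdge d, windowLoad d suppV oscV (starWinZd c) ≤ BV) (hBV0 : 0 ≤ BV) (hs₀ : 0 < s₀)
    (hD : max R RV + 2 ≤ D) (hρ0 : 0 ≤ ρ) (hρ1 : ρ < 1)
    (hwin : ∀ (T : Set (Finset (ZdEdge d))) (s : ℝ), |s| ≤ s₀ → StarWindowBoundZdR d N
      (perturbedYM (d := d) (fundamentalRep (Fin N)) (N * β) (W + s • T.indicator V) (fun Λ => supp Λ ∪ suppV Λ)) D ρ suFrobDist)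
    {lipV : Finset (ZdEdge d) → ZdEdge d → ℝ} (hlipV : ∀ X, IsLipBound suFrobDist (V X) (lipV X))
    (hLs : ∀ e, Summable fun X : Finset (ZdEdge d) => (if e ∈ X then ∑ y ∈ X, lipV X y else 0))
    (hL : ∀ e, ∑' X : Finset (ZdEdge d), (if e ∈ X then ∑ y ∈ X, lipV X y else 0) ≤ L)
    (hL2s : ∀ e, Summable fun X : Finset (ZdEdge d) => (if e ∈ X then X.card * ∑ y ∈ X, lipV X y else 0))
    (hL2 : ∀ e, ∑' X : Finset (ZdEdge d), (if e ∈ X then X.card * ∑ y ∈ X, lipV X y else 0) ≤ L₂)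
    (hV'c : ∀ X, Continuous (V' X)) (hV'dep : ∀ X, DependsOn (V' X) (↑X : Set (ZdEdge d)))
    {lipV' : Finset (ZdEdge d) → ZdEdge d → ℝ} (hlipV' : ∀ X, IsLipBound suFrobDist (V' X) (lipV' X))
    (hL's : ∀ e, Summable fun X : Finset (ZdEdge d) => (if e ∈ X then ∑ y ∈ X, lipV' X y else 0))
    (hL' : ∀ e, ∑' X : Finset (ZdEdge d), (if e ∈ X then ∑ y ∈ X, lipV' X y else 0) ≤ L')
    (hL2's : ∀ e, Summable fun X : Finset (ZdEdge d) => (if e ∈ X then X.card * ∑ y ∈ X, lipV' X y else 0))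
    (hL2' : ∀ e, ∑' X : Finset (ZdEdge d), (if e ∈ X then X.card * ∑ y ∈ X, lipV' X y else 0) ≤ L₂')
    {ν : ℝ → Measure (LGConfig d (SUN N))}
    (hν : ∀ s ∈ Set.Icc (-s₀) s₀, ν s ∈ perturbedGibbsMeasures (d := d) (fundamentalRep (Fin N)) (N * β) (W + s • V)
      (fun Λ => supp Λ ∪ suppV Λ))
    {F : LGConfig d (SUN N) → ℝ} (hFm : Measurable F) {ΛF : Finset (ZdEdge d)} (hFdep : DependsOn F (↑ΛF : Set (ZdEdge d)))
    {MF : ℝ} (hMF : ∀ σ, |F σ| ≤ MF) {δF : ZdEdge d → ℝ} (hδF : IsLipBound suFrobDist F δF) :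
    (∀ s ∈ Set.Ioo (-s₀) s₀, HasDerivAt (fun s => ∑' X : Finset (ZdEdge d), cov[F, V' X; ν s])
      (-(∑' p : Finset (ZdEdge d) × Finset (ZdEdge d), (cov[fun U => F U * V' p.1 U, V p.2; ν s] -
        (∫ U, F U ∂(ν s)) * cov[V' p.1, V p.2; ν s] - (∫ U, V' p.1 U ∂(ν s)) * cov[F, V p.2; ν s]))) s) ∧
    ContinuousOn (fun s => ∑' p : Finset (ZdEdge d) × Finset (ZdEdge d), (cov[fun U => F U * V' p.1 U, V p.2; ν s] -
        (∫ U, F U ∂(ν s)) * cov[V' p.1, V p.2; ν s] - (∫ U, V' p.1 U ∂(ν s)) * cov[F, V p.2; ν s])) (Set.Icc (-s₀) s₀) := by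
  classical
  haveI : SecondCountableTopology (Matrix (Fin N) (Fin N) ℂ) :=
    inferInstanceAs (SecondCountableTopology (Fin N → Fin N → ℂ))
  haveI : SecondCountableTopology (SUN N) := Topology.IsEmbedding.subtypeVal.secondCountableTopology
  set I : Set ℝ := Set.Ioo (-s₀) s₀ with hI; set J : Set ℝ := Set.Icc (-s₀) s₀ with hJ
  have hII : I ⊆ J := Set.Ioo_subset_Icc_self; have habs : ∀ {s}, s ∈ J → |s| ≤ s₀ := fun hs => abs_le.2 ⟨by linarith [hs.1], hs.2⟩
  set fam : Finset (ZdEdge d) → Finset (Finset (ZdEdge d)) := fun Λ => supp Λ ∪ suppV Λ with hfam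
  obtain ⟨T, hT⟩ := exists_term_exhaustion d
  have hT' : ∀ A : Finset (ZdEdge d), V A ≠ 0 → ∀ᶠ n in atTop, A ∈ T n := fun A _ =>
    (tendsto_atTop.1 hT {A}).mono fun n hn => hn (Finset.mem_singleton_self A)
  -- members along the lines (big ball, family `fam`), their specifications and star kernels
  have hline : ∀ (Tset : Set (Finset (ZdEdge d))) {s : ℝ}, |s| ≤ s₀ →
      MemBallZdG (ε₀ + s₀ * ε₀V) (ε₁ + s₀ * ε₁V) (max R RV) (W + s • Tset.indicator V) fam :=
    fun Tset s hs => hW.add_smul_indicator hV h₀V h₁V le_rfl le_rfl hs Tset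
  have hD1 : 1 ≤ D := by omega
  have hspec : ∀ (Tset : Set (Finset (ZdEdge d))) {s : ℝ}, s ∈ J →
      IsSpecification (perturbedYM (d := d) (fundamentalRep (Fin N)) (N * β) (W + s • Tset.indicator V) fam) ∧
      ∀ (c : ZdEdge d) (ζ ζ' : LGConfig d (SUN N)), (∀ v ∈ starNbhdZdR D c.1, ζ v = ζ' v) →
        ∀ (g : LGConfig d (SUN N) → ℝ), Measurable g → (∃ B, ∀ σ, |g σ| ≤ B) → DependsOn g (starWinZd c : Set (ZdEdge d)) →
          ∫ σ, g σ ∂(perturbedYM (d := d) (fundamentalRep (Fin N)) (N * β) (W + s • Tset.indicator V) fam (starWinZd c) ζ) =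
            ∫ σ, g σ ∂(perturbedYM (d := d) (fundamentalRep (Fin N)) (N * β) (W + s • Tset.indicator V) fam (starWinZd c) ζ') := by
    intro Tset s hs
    have hm := hline Tset (habs hs)
    have hmA : (W + s • Tset.indicator V).IsAdapted := fun X => ⟨hm.dependsOn X, (hm.continuous X).measurable⟩
    have hmb : ∀ X, ∃ C, ∀ U, |(W + s • Tset.indicator V) X U| ≤ C := fun X => exists_bound_of_continuous (hm.continuous X)
    exact ⟨isSpecification_perturbedYM _ (continuous_fundamentalRep (Fin N)) _ hmA hmb hm.supportedBy,
      fun c ζ ζ' hζ g hgm _ hgdep => perturbed_star_hloc _ (continuous_fundamentalRep (Fin N)) _ (fun X => (hm.continuous X).measurable)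
        hm.dependsOn hm.supportedBy hm.range hD c ζ ζ' hζ g hgm hgdep⟩
  -- the base `W` itself with family `fam`: uniqueness and a state `μ`
  have hW' : MemBallZdG (ε₀ + s₀ * ε₀V) (ε₁ + s₀ * ε₁V) (max R RV) W fam := by
    have h := hline ∅ (s := 0) (by rw [abs_zero]; exact hs₀.le)
    rwa [Set.indicator_empty', smul_zero, add_zero] at h
  have hwin0 : StarWindowBoundZdR d N (perturbedYM (d := d) (fundamentalRep (Fin N)) (N * β) W fam) D ρ suFrobDist := by
    have h := hwin ∅ 0 (by rw [abs_zero]; exact hs₀.le)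
    rwa [Set.indicator_empty', smul_zero, add_zero] at h
  have hgap := perturbedMassGapAt_of_starWindowBoundZdR hW'.continuous hW'.dependsOn hW'.supportedBy hW'.range hD hρ0 hρ1 hwin0
  have huniq : (perturbedGibbsMeasures (d := d) (fundamentalRep (Fin N)) (N * β) W fam).Subsingleton := hgap.1.1
  obtain ⟨μ, hμ'⟩ : (perturbedGibbsMeasures (d := d) (fundamentalRep (Fin N)) (N * β) W fam).Nonempty := hgap.1.2
  have hWA : W.IsAdapted := fun X => ⟨hW.dependsOn X, (hW.continuous X).measurable⟩
  have hWb : ∀ X, ∃ C, ∀ U, |W X U| ≤ C := fun X => exists_bound_of_continuous (hW.continuous X)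
  have hVb : ∀ X, ∃ C, ∀ U, |V X U| ≤ C := fun X => exists_bound_of_continuous (hV.continuous X)
  have hVb' : ∀ X, ∃ C, ∀ U, |V' X U| ≤ C := fun X => exists_bound_of_continuous (hV'c X)
  have hVm : ∀ X, Measurable (V X) := fun X => (hV.continuous X).measurable; have hV'm : ∀ X, Measurable (V' X) := fun X => (hV'c X).measurable
  -- the truncated directions and the tilted states along the truncated lines
  set Vn : ℕ → Potential (ZdEdge d) (SUN N) := fun n => (↑(T n) : Set (Finset (ZdEdge d))).indicator V with hVn
  have hVnc : ∀ n X, Continuous (Vn n X) := fun n X => continuous_indicator_apply hV.continuous X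
  have hVndep : ∀ n X, DependsOn (Vn n X) (↑X : Set (ZdEdge d)) := fun n X => dependsOn_indicator_apply hV.dependsOn X
  have hVnA : ∀ n, (Vn n).IsAdapted := fun n X => ⟨hVndep n X, (hVnc n X).measurable⟩
  have hVnb : ∀ n X, ∃ C, ∀ U, |Vn n X U| ≤ C := fun n X => exists_bound_of_continuous (hVnc n X)
  have hVnsupp : ∀ n, (Vn n).IsSupportedBy fun _ => T n := fun n => isSupportedBy_indicator (T n) V
  set νn : ℕ → ℝ → Measure (LGConfig d (SUN N)) := fun n s => μ.tilted fun U => -s * ∑ A ∈ T n, Vn n A U with hνn_def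
  have hνn₁ : ∀ n s, νn n s ∈ perturbedGibbsMeasures (d := d) (fundamentalRep (Fin N)) (N * β) (W + s • Vn n)
      (fun Λ => fam Λ ∪ T n) := fun n s => by
    rw [perturbedGibbsMeasures_add_smul_eq_singleton (fundamentalRep (Fin N)) (continuous_fundamentalRep (Fin N)) (N * β) hWA hWb
      hW'.supportedBy (hVnA n) (hVnb n) (hVnsupp n) (fun _ => subset_rfl) huniq hμ' s]
    exact Set.mem_singleton _
  have hνn : ∀ n s, s ∈ J → νn n s ∈ perturbedGibbsMeasures (d := d) (fundamentalRep (Fin N)) (N * β) (W + s • Vn n) fam := by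
    intro n s hs
    have h1 : (W + s • Vn n).IsSupportedBy (fun Λ => fam Λ ∪ T n) := by
      refine isSupportedBy_add_union hW'.supportedBy fun Λ A hA hne => hVnsupp n Λ A hA fun h0 => hne ?_
      rw [Pi.smul_apply, h0, smul_zero]
    rw [perturbedGibbsMeasures_congr_of_isSupportedBy (fundamentalRep (Fin N)) (N * β) (hline _ (habs hs)).supportedBy h1]
    exact hνn₁ n s
  have hprob_n : ∀ n s, IsProbabilityMeasure (νn n s) := fun n s => (show IsGibbsMeasure _ _ from hνn₁ n s).isProbabilityMeasure
  have hprob : ∀ s ∈ J, IsProbabilityMeasure (ν s) := fun s hs => (show IsGibbsMeasure _ _ from hν s hs).isProbabilityMeasure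
  have hνuniv : ∀ s ∈ J, ν s ∈ perturbedGibbsMeasures (d := d) (fundamentalRep (Fin N)) (N * β) (W + s • Set.univ.indicator V) fam :=
    fun s hs => by rw [Set.indicator_univ]; exact hν s hs
  -- uniform convergence of expectations and covariances along the truncations (screened stability through the star door)
  have hunif : ∀ {g : LGConfig d (SUN N) → ℝ} {Δ : Finset (ZdEdge d)} {M : ℝ} {δ : ZdEdge d → ℝ},
      Measurable g → DependsOn g (↑Δ : Set (ZdEdge d)) → (∀ σ, |g σ| ≤ M) → IsLipBound suFrobDist g δ →
      TendstoUniformlyOn (fun n s => ∫ σ, g σ ∂(νn n s)) (fun s => ∫ σ, g σ ∂(ν s)) atTop J :=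
    fun hgm hgdep hM hδ => tendstoUniformlyOn_integral_truncation_star hW hV hoscV hBV hBV0 hs₀.le h₀V h₁V hD hρ0 hρ1 (T := T)
      (fun n s hs => hwin _ s hs) hT' hνn hν hgm hM hgdep hδ
  have hMF0 : 0 ≤ MF := (abs_nonneg _).trans (hMF fun _ => 1)
  have hcovconv : ∀ {f g : LGConfig d (SUN N) → ℝ} {Δf Δg : Finset (ZdEdge d)} {Mf Mg : ℝ} {δf δg : ZdEdge d → ℝ},
      Measurable f → DependsOn f (↑Δf : Set (ZdEdge d)) → (∀ σ, |f σ| ≤ Mf) → IsLipBound suFrobDist f δf →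
      Measurable g → DependsOn g (↑Δg : Set (ZdEdge d)) → (∀ σ, |g σ| ≤ Mg) → IsLipBound suFrobDist g δg →
      TendstoUniformlyOn (fun n s => cov[f, g; νn n s]) (fun s => cov[f, g; ν s]) atTop J := by
    intro f g Δf Δg Mf Mg δf δg hfm hfdep hMf hδf hgm hgdep hMg hδg
    have hMf0 : 0 ≤ Mf := (abs_nonneg _).trans (hMf fun _ => 1)
    have hMg0 : 0 ≤ Mg := (abs_nonneg _).trans (hMg fun _ => 1)
    exact tendstoUniformlyOn_cov (fun n s _ => hprob_n n s) (fun s hs => hprob s hs) hfm hgm hMf0 hMg0 hMf hMg (hunif hfm hfdep hMf hδf)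
      (hunif hgm hgdep hMg hδg) (hunif (hfm.mul hgm) (dependsOn_mul_union hfdep hgdep)
        (fun σ => by rw [abs_mul]; exact mul_le_mul (hMf σ) (hMg σ) (abs_nonneg _) hMf0)
        (isLipBound_mul_of_abs_le (fun _ _ => suFrobDist_nonneg _ _) hMf0 hMg0 hMf hMg hδf hδg))
  -- the rate and the first-level majorant (direction `V'`)
  set ρ' : ℝ := max ρ (1 / 2) with hρ'
  have hρ'0 : 0 < ρ' := lt_of_lt_of_le (by norm_num) (le_max_right _ _); have hρ'1 : ρ' < 1 := max_lt hρ1 (by norm_num)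
  set t : ℝ := -Real.log ρ' / (D + 2 : ℕ) with ht
  have htpos : 0 < t := div_pos (by have := Real.log_neg hρ'0 hρ'1; linarith) (by positivity)
  set A₀ : ℝ := 2 * (2 * Real.sqrt N) ^ 2 * (∑ y ∈ ΛF, δF y) * ρ'⁻¹ with hA₀
  set LX : Finset (ZdEdge d) → ℝ := fun X => ∑ y ∈ X, lipV X y with hLX
  set LX' : Finset (ZdEdge d) → ℝ := fun X => ∑ y ∈ X, lipV' X y with hLX'
  set g₀ : ZdEdge d → ℝ := fun e => exp (-t * linkSetDist ΛF e) with hg₀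
  set Φ : Finset (ZdEdge d) → ℝ := fun X => A₀ * LX' X * ∑ e ∈ X, g₀ e with hΦ
  have hδ0 : 0 ≤ ∑ y ∈ ΛF, δF y := sum_nonneg fun y _ => hδF.nonneg y; have hA₀0 : 0 ≤ A₀ := by positivity
  have hLX0 : ∀ X, 0 ≤ LX X := fun X => sum_nonneg fun y _ => (hlipV X).nonneg y
  have hLX'0 : ∀ X, 0 ≤ LX' X := fun X => sum_nonneg fun y _ => (hlipV' X).nonneg y; have hg₀0 : ∀ e, 0 ≤ g₀ e := fun e => (exp_pos _).le
  have hΦ0 : ∀ X, 0 ≤ Φ X := fun X => mul_nonneg (mul_nonneg hA₀0 (hLX'0 X)) (sum_nonneg fun e _ => hg₀0 e)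
  have hd0 : 0 < d := hd
  have hL'0 : 0 ≤ L' := le_trans (tsum_nonneg fun X => by split_ifs; exacts [hLX'0 X, le_rfl]) (hL' (0, ⟨0, hd0⟩))
  have hΦs : Summable Φ := by
    refine summable_of_sum_le hΦ0 (c := A₀ * L' * (ΛF.card * (d * ((1 + exp (-(t / d))) / (1 - exp (-(t / d)))) ^ d)))
      fun Tf => ?_
    have h1 : ∑ X ∈ Tf, Φ X = A₀ * ∑ X ∈ Tf, LX' X * ∑ e ∈ X, g₀ e := by rw [mul_sum]; exact sum_congr rfl fun X _ => by ring
    rw [h1]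
    by_cases hΛF : ΛF.Nonempty
    · obtain ⟨hgs, hgt⟩ := summable_exp_neg_linkSetDist hd htpos hΛF
      calc A₀ * ∑ X ∈ Tf, LX' X * ∑ e ∈ X, g₀ e
          ≤ A₀ * (L' * (ΛF.card * (d * ((1 + exp (-(t / d))) / (1 - exp (-(t / d)))) ^ d))) :=
            mul_le_mul_of_nonneg_left ((sum_mul_sum_le_of_load hg₀0 hgs hLX'0 hL'0 hL's hL').trans
              (mul_le_mul_of_nonneg_left hgt hL'0)) hA₀0
        _ = _ := by ring
    · simp [hA₀, Finset.not_nonempty_iff_eq_empty.1 hΛF]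
  have hbound : ∀ (Tset : Set (Finset (ZdEdge d))) {s : ℝ}, s ∈ J → ∀ {μ' : Measure (LGConfig d (SUN N))},
      μ' ∈ perturbedGibbsMeasures (d := d) (fundamentalRep (Fin N)) (N * β) (W + s • Tset.indicator V) fam → ∀ X, |cov[F, V' X; μ']| ≤ Φ X := by
    intro Tset s hs μ' hμ'' X
    obtain ⟨hγ, hloc⟩ := hspec Tset hs
    obtain ⟨CX, hCX⟩ := hVb' X
    have h1 := abs_covariance_le_of_starWindowBoundZdR_geometric hγ hD1 hloc hρ0 hρ1 (hwin Tset s (habs hs)) hμ'' hFm (hV'm X) hMF hCX hFdep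
      (hV'dep X) hδF (hlipV' X)
    have h2 : |cov[F, V' X; μ']| ≤ A₀ * LX' X * exp (-(t * setDistEdges ΛF X)) := by
      refine h1.trans ?_
      have hp := pow_floor_le_exp (x := setDistEdges ΛF X) hρ0 hρ1 D
      calc 2 * (2 * Real.sqrt N) ^ 2 * ρ ^ ⌊setDistEdges ΛF X / (D + 2 : ℕ)⌋₊ * (∑ x ∈ ΛF, δF x) * ∑ y ∈ X, lipV' X y
          ≤ 2 * (2 * Real.sqrt N) ^ 2 * (ρ'⁻¹ * exp (-(-Real.log ρ' / (D + 2 : ℕ)) * setDistEdges ΛF X)) * (∑ x ∈ ΛF, δF x) *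
              ∑ y ∈ X, lipV' X y := by gcongr; exact hLX'0 X
        _ = A₀ * LX' X * exp (-(t * setDistEdges ΛF X)) := by simp only [hA₀, hLX', ht, neg_mul]; ring
    refine le_mul_sum_exp_of_le_mul_exp htpos.le hA₀0 (hLX'0 X) h2 (fun hX => ?_) (fun hΔ => ?_)
    · simp only [hLX', Finset.not_nonempty_iff_eq_empty.1 hX, sum_empty]
    · simp only [hA₀, Finset.not_nonempty_iff_eq_empty.1 hΔ, sum_empty, mul_zero, zero_mul]
  have hc₁ : ∀ n, ∀ s ∈ J, ∀ X, |cov[F, V' X; νn n s]| ≤ Φ X := fun n s hs X => hbound _ hs (hνn n s hs) X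
  have hcinf₁ : ∀ s ∈ J, ∀ X, |cov[F, V' X; ν s]| ≤ Φ X := fun s hs X => hbound Set.univ hs (hνuniv s hs) X
  have hconv₁ : ∀ X, TendstoUniformlyOn (fun n s => cov[F, V' X; νn n s]) (fun s => cov[F, V' X; ν s]) atTop J := fun X => by
    obtain ⟨CX, hCX⟩ := hVb' X
    exact hcovconv hFm hFdep hMF hδF (hV'm X) (hV'dep X) hCX (hlipV' X)
  have hU₁ := tendstoUniformlyOn_finsetSum_tsum hT hΦ0 hΦs hc₁ hcinf₁ hconv₁
  -- the second-level majorant on pairs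
  obtain ⟨Sf, hSf⟩ : ∃ S : ℝ, S = ∑ y ∈ ΛF, ρ'⁻¹ * δF y := ⟨_, rfl⟩
  have hSf' : Sf = ρ'⁻¹ * ∑ y ∈ ΛF, δF y := by rw [hSf, mul_sum]
  obtain ⟨gD, hgD⟩ : ∃ g : Finset (ZdEdge d) → ZdEdge d → ℝ, g = fun Δ e => exp (-(t / 3) * linkSetDist Δ e) := ⟨_, rfl⟩
  obtain ⟨Cs, hCs⟩ : ∃ C : ℝ, C = (d : ℝ) * ((1 + exp (-(t / 3 / d))) / (1 - exp (-(t / 3 / d)))) ^ d := ⟨_, rfl⟩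
  set Φ₂ : Finset (ZdEdge d) × Finset (ZdEdge d) → ℝ := fun p => 768 * N * Real.sqrt N * Sf * (LX' p.1 * LX p.2 *
      ((∑ e ∈ p.1, gD ΛF e) * (∑ e ∈ p.2, gD ΛF e) + (∑ e ∈ p.1, gD ΛF e) * (∑ e ∈ p.2, gD p.1 e) +
        (∑ e ∈ p.2, gD ΛF e) * (∑ e ∈ p.1, gD p.2 e))) with hΦ₂
  have hSf0 : 0 ≤ Sf := by rw [hSf']; exact mul_nonneg (inv_pos.2 hρ'0).le hδ0
  have hgD0 : ∀ Δ e, 0 ≤ gD Δ e := fun Δ e => by rw [hgD]; exact (exp_pos _).le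
  have hG0 : ∀ Δ (Z : Finset (ZdEdge d)), 0 ≤ ∑ e ∈ Z, gD Δ e := fun Δ Z => sum_nonneg fun e _ => hgD0 _ _
  have hΦ₂0 : ∀ p, 0 ≤ Φ₂ p := fun p => by
    have := hLX'0 p.1; have := hLX0 p.2; have := hG0 ΛF p.1; have := hG0 ΛF p.2; have := hG0 p.1 p.2; have := hG0 p.2 p.1
    simp only [hΦ₂]; positivity
  have hΦ₂s : Summable Φ₂ := by
    refine summable_of_sum_le hΦ₂0
      (c := 768 * N * Real.sqrt N * Sf * (ΛF.card * Cs) * (L' * L * (ΛF.card * Cs) + L * L₂' * Cs + L' * L₂ * Cs)) fun S => ?_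
    have hsub : S ⊆ S.image Prod.fst ×ˢ S.image Prod.snd := fun p hp =>
      Finset.mem_product.2 ⟨Finset.mem_image_of_mem _ hp, Finset.mem_image_of_mem _ hp⟩
    refine (Finset.sum_le_sum_of_subset_of_nonneg hsub fun _ _ _ => hΦ₂0 _).trans ?_
    rw [Finset.sum_product]
    exact sum_majorant_le_S (N := N) (ΛF := ΛF) hd htpos (δF := fun y => ρ'⁻¹ * δF y)
      (fun y => mul_nonneg (inv_pos.2 hρ'0).le (hδF.nonneg y)) hlipV' hL's hL' hL2's hL2' hlipV hLs hL hL2s hL2 rfl hSf hLX' hLX hgD hCs _ _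
  have hbound₂ : ∀ (Tset : Set (Finset (ZdEdge d))) {s : ℝ}, s ∈ J → ∀ {μ' : Measure (LGConfig d (SUN N))},
      μ' ∈ perturbedGibbsMeasures (d := d) (fundamentalRep (Fin N)) (N * β) (W + s • Tset.indicator V) fam →
      ∀ p : Finset (ZdEdge d) × Finset (ZdEdge d),
        |cov[fun U => F U * V' p.1 U, V p.2; μ'] - (∫ U, F U ∂μ') * cov[V' p.1, V p.2; μ'] - (∫ U, V' p.1 U ∂μ') * cov[F, V p.2; μ']| ≤
          Φ₂ p := by
    intro Tset s hs μ' hμ'' p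
    obtain ⟨hγ, hloc⟩ := hspec Tset hs
    exact abs_threePoint_le_majorant_star hd hγ hD1 hloc hρ0 hρ1 (hwin Tset s (habs hs)) hμ'' ht hFm hFdep hMF hδF hV'm hV'dep hVb' hlipV'
      hVm hV.dependsOn hVb hlipV rfl hSf' hLX' hLX hgD p.1 p.2
  have hc₂ : ∀ n, ∀ s ∈ J, ∀ p : Finset (ZdEdge d) × Finset (ZdEdge d),
      |cov[fun U => F U * V' p.1 U, V p.2; νn n s] - (∫ U, F U ∂(νn n s)) * cov[V' p.1, V p.2; νn n s] -
        (∫ U, V' p.1 U ∂(νn n s)) * cov[F, V p.2; νn n s]| ≤ Φ₂ p := fun n s hs p => hbound₂ _ hs (hνn n s hs) p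
  have hcinf₂ : ∀ s ∈ J, ∀ p : Finset (ZdEdge d) × Finset (ZdEdge d),
      |cov[fun U => F U * V' p.1 U, V p.2; ν s] - (∫ U, F U ∂(ν s)) * cov[V' p.1, V p.2; ν s] -
        (∫ U, V' p.1 U ∂(ν s)) * cov[F, V p.2; ν s]| ≤ Φ₂ p := fun s hs p => hbound₂ Set.univ hs (hνuniv s hs) p
  -- the exhaustion of pairs
  have hT₂ : Tendsto (fun n => T n ×ˢ T n) atTop atTop := by
    rw [tendsto_atTop_atTop]
    intro S
    obtain ⟨n₀, hn₀⟩ := tendsto_atTop_atTop.1 hT (S.image Prod.fst ∪ S.image Prod.snd)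
    refine ⟨n₀, fun n hn p hp => Finset.mem_product.2 ⟨?_, ?_⟩⟩
    · exact hn₀ n hn (Finset.mem_union_left _ (Finset.mem_image_of_mem _ hp))
    · exact hn₀ n hn (Finset.mem_union_right _ (Finset.mem_image_of_mem _ hp))
  -- uniform convergence of the third cumulants along the truncations
  have hconv₂ : ∀ p : Finset (ZdEdge d) × Finset (ZdEdge d), TendstoUniformlyOn
      (fun n s => cov[fun U => F U * V' p.1 U, V p.2; νn n s] - (∫ U, F U ∂(νn n s)) * cov[V' p.1, V p.2; νn n s] -
        (∫ U, V' p.1 U ∂(νn n s)) * cov[F, V p.2; νn n s])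
      (fun s => cov[fun U => F U * V' p.1 U, V p.2; ν s] - (∫ U, F U ∂(ν s)) * cov[V' p.1, V p.2; ν s] -
        (∫ U, V' p.1 U ∂(ν s)) * cov[F, V p.2; ν s]) atTop J := by
    intro p
    obtain ⟨CX, hCX⟩ := hVb' p.1
    obtain ⟨CY, hCY⟩ := hVb p.2
    have hCX0 : 0 ≤ CX := (abs_nonneg _).trans (hCX fun _ => 1); have hCY0 : 0 ≤ CY := (abs_nonneg _).trans (hCY fun _ => 1)
    have h1 := hcovconv (show Measurable (fun U => F U * V' p.1 U) from hFm.mul (hV'm p.1)) (dependsOn_mul_union hFdep (hV'dep p.1))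
      (fun σ => (abs_mul _ _).trans_le (mul_le_mul (hMF σ) (hCX σ) (abs_nonneg _) hMF0))
      (isLipBound_mul_of_abs_le (fun _ _ => suFrobDist_nonneg _ _) hMF0 hCX0 hMF hCX hδF (hlipV' p.1)) (hVm p.2) (hV.dependsOn p.2) hCY
      (hlipV p.2)
    have h2 := hcovconv (hV'm p.1) (hV'dep p.1) hCX (hlipV' p.1) (hVm p.2) (hV.dependsOn p.2) hCY (hlipV p.2)
    have h3 := hcovconv hFm hFdep hMF hδF (hVm p.2) (hV.dependsOn p.2) hCY (hlipV p.2)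
    have h24 := tendstoUniformlyOn_mul_of_abs_le (M₁ := MF) (M₂ := 2 * CX * CY) hMF0 (by positivity) (hunif hFm hFdep hMF hδF) h2
      (fun s hs => by haveI := hprob s hs; exact abs_integral_le_of_abs_le hMF)
      (fun s hs => by haveI := hprob s hs; exact abs_covariance_le_two_mul (hV'm p.1) hCX (hVm p.2) hCY)
    have h35 := tendstoUniformlyOn_mul_of_abs_le (M₁ := CX) (M₂ := 2 * MF * CY) hCX0 (by positivity)
      (hunif (hV'm p.1) (hV'dep p.1) hCX (hlipV' p.1)) h3 (fun s hs => by haveI := hprob s hs; exact abs_integral_le_of_abs_le hCX)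
      (fun s hs => by haveI := hprob s hs; exact abs_covariance_le_two_mul hFm hMF (hVm p.2) hCY)
    exact (h1.sub h24).sub h35
  have hU₂ := tendstoUniformlyOn_finsetSum_tsum hT₂ hΦ₂0 hΦ₂s hc₂ hcinf₂ hconv₂
  -- each pair-truncated cumulant sum is continuous in `s` (tilt formula), hence so is the uniform limit
  have hcont₂ : ∀ n, ContinuousOn (fun s => ∑ p ∈ T n ×ˢ T n, (cov[fun U => F U * V' p.1 U, V p.2; νn n s] -
      (∫ U, F U ∂(νn n s)) * cov[V' p.1, V p.2; νn n s] - (∫ U, V' p.1 U ∂(νn n s)) * cov[F, V p.2; νn n s])) J := by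
    intro n
    choose CA hCA using fun A => exists_bound_of_continuous (hVnc n A)
    have hHm : Measurable fun U : LGConfig d (SUN N) => ∑ A ∈ T n, Vn n A U := Finset.measurable_sum _ fun A _ => (hVnc n A).measurable
    have hHb : ∀ U : LGConfig d (SUN N), |∑ A ∈ T n, Vn n A U| ≤ ∑ A ∈ T n, CA A := fun U =>
      (Finset.abs_sum_le_sum_abs _ _).trans (Finset.sum_le_sum fun A _ => hCA A U)
    haveI := (show IsGibbsMeasure _ μ from hμ').isProbabilityMeasure
    have hint : ∀ {g : LGConfig d (SUN N) → ℝ} {M : ℝ}, Measurable g → (∀ σ, |g σ| ≤ M) → Continuous fun s => ∫ σ, g σ ∂(νn n s) :=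
      fun hgm hM => continuous_iff_continuousAt.2 fun s =>
        (hasDerivAt_integral_tilted_of_bounded (μ := μ) hHm hHb hgm.aestronglyMeasurable hM s).continuousAt
    have hcovc : ∀ {f g : LGConfig d (SUN N) → ℝ} {Mf Mg : ℝ}, Measurable f → Measurable g →
        (∀ σ, |f σ| ≤ Mf) → (∀ σ, |g σ| ≤ Mg) → Continuous fun s => cov[f, g; νn n s] := by
      intro f g Mf Mg hfm hgm hMf hMg
      have hMf0 : 0 ≤ Mf := (abs_nonneg _).trans (hMf fun _ => 1)
      have heq : (fun s => cov[f, g; νn n s]) = fun s => (∫ σ, f σ * g σ ∂(νn n s)) - (∫ σ, f σ ∂(νn n s)) * ∫ σ, g σ ∂(νn n s) :=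
        funext fun s => by
          have hf2 : MemLp f 2 (νn n s) :=
            MemLp.of_bound hfm.aestronglyMeasurable Mf (Eventually.of_forall fun σ => by rw [Real.norm_eq_abs]; exact hMf σ)
          have hg2 : MemLp g 2 (νn n s) :=
            MemLp.of_bound hgm.aestronglyMeasurable Mg (Eventually.of_forall fun σ => by rw [Real.norm_eq_abs]; exact hMg σ)
          rw [covariance_eq_sub hf2 hg2]; rfl
      rw [heq]
      exact (hint (show Measurable (fun σ => f σ * g σ) from hfm.mul hgm) (M := Mf * Mg) fun σ =>
        (abs_mul _ _).trans_le (mul_le_mul (hMf σ) (hMg σ) (abs_nonneg _) hMf0)).sub ((hint hfm hMf).mul (hint hgm hMg))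
    refine continuousOn_finsetSum _ fun p _ => Continuous.continuousOn ?_
    obtain ⟨CX, hCX⟩ := hVb' p.1
    obtain ⟨CY, hCY⟩ := hVb p.2
    exact ((hcovc (show Measurable (fun U => F U * V' p.1 U) from hFm.mul (hV'm p.1)) (hVm p.2)
      (fun σ => (abs_mul _ _).trans_le (mul_le_mul (hMF σ) (hCX σ) (abs_nonneg _) hMF0)) hCY).sub
      ((hint hFm hMF).mul (hcovc (hV'm p.1) (hVm p.2) hCX hCY))).sub ((hint (hV'm p.1) hCX).mul (hcovc hFm (hVm p.2) hMF hCY))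
  -- Feynman–Hellmann for the truncated susceptibility sums, on pairs
  have hderiv : ∀ n, ∀ s ∈ I, HasDerivAt (fun s => ∑ X ∈ T n, cov[F, V' X; νn n s])
      (-(∑ p ∈ T n ×ˢ T n, (cov[fun U => F U * V' p.1 U, V p.2; νn n s] - (∫ U, F U ∂(νn n s)) * cov[V' p.1, V p.2; νn n s] -
        (∫ U, V' p.1 U ∂(νn n s)) * cov[F, V p.2; νn n s]))) s := by
    intro n s _
    have hX : ∀ X ∈ T n, HasDerivAt (fun s => cov[F, V' X; νn n s])
        (-(∑ A ∈ T n, (cov[fun U => F U * V' X U, V A; νn n s] - (∫ U, F U ∂(νn n s)) * cov[V' X, V A; νn n s] -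
          (∫ U, V' X U ∂(νn n s)) * cov[F, V A; νn n s]))) s := by
      intro X _
      obtain ⟨CX, hCX⟩ := hVb' X
      have h := hasDerivAt_cov_of_mem_perturbedGibbsMeasures_add_smul (fundamentalRep (Fin N)) (continuous_fundamentalRep (Fin N)) (N * β)
        hWA hWb hW'.supportedBy (hVnA n) (hVnb n) (hVnsupp n) (fun _ => subset_rfl) huniq hμ' (hνn₁ n) hFm hMF (hV'm X) hCX s
      refine h.congr_deriv ?_
      congr 1
      refine sum_congr rfl fun A hA => ?_
      simp only [hVn, Set.indicator_of_mem (Finset.mem_coe.2 hA)]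
    have hs := HasDerivAt.fun_sum hX
    rw [Finset.sum_product, ← sum_neg_distrib]
    exact hs
  -- assemble with the truncated-series derivative lemma on pairs
  exact ⟨fun s hs => hasDerivAt_of_truncations hT₂ hΦ₂0 hΦ₂s isOpen_Ioo (fun n s hs p => hc₂ n s (hII hs) p)
      (fun s hs p => hcinf₂ s (hII hs) p) (fun p => (hconv₂ p).mono hII) hderiv (fun s hs => hU₁.tendsto_at (hII hs)) hs,
    hU₂.continuousOn (Eventually.of_forall hcont₂).frequently⟩

end Main

end Summit.Ventures.YMGap.RobustBall

end
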